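import Mathlib
import HarnessLib
import Literature.MathematicalPhysics.QuantumFieldTheory.CurvatureGaussianField
import Literature.MathematicalPhysics.QuantumLattice.LatticeScalarField

/-!
# Route `StaticSourceWitness`, crux X₁ `StaticSourceResponse` (stmt-QuantumFields-25284):
# objects of the lattice-Maxwell rung (BC5 / T3 witness) — definitions only

Banking file 0/5 (`--supports stmt-QuantumFields-25284`): the Theorems-side port of the crux workfile
`Cruxes/StaticSourceResponse/Lines/rung.lean` v3 (tribunal-w seat `ym-mirror-bc5w-1`, 2026-08-28;
0 sorry), split into ≤ 400-line modules.  This module holds the DEFINITIONS the five theorem files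
(`StaticSourceWitnessRungGaussianMoments`, `…GaussianPair`, `…LatticeResponse`, `…KernelCone`,
`…DipoleEnergyFloor`) talk about; no theorem of substance is proved here.

* Part A (Gaussian model): `γ` (standard normal law), `F t = e^{−t²/2}` (complex-valued), `μ2 = γ ⊗ γ`,
  the Cholesky map `cholT s p q (ξ₁, ξ₂) = (s ξ₁, p ξ₁ + q ξ₂)`.
* Part B (lattice Maxwell field `μM = curvatureGaussianField 4 1` of `ℤ⁴`, Garban–Sepúlveda `dGd*`
  covariance): configurations `Cfg`, coordinate planes `Plane`, the source rectangle `rectPlaq`, its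
  abelian holonomy angle `holonomy` (lattice Stokes) and Wilson loop `wLoop = cos ∘ holonomy`, the
  classical linear-response field `dipoleField`, the plaquette star `plaqAt`, the cube `cube L`, the
  abelian energy density `densA`, the probe `probe a v L = ∑_y v(a y) densA y`, the probe-weighted
  classical field energy `dipoleEnergy`.
* Part C (hyperscaling configuration): the `(1,2)` plane `P12`, squared site length `S`, the probe
  bump `wfun ℓ` (centre `ctr ℓ = (ℓ/2)e₀`, radii `ℓ/8, ℓ/4`), the source base point `xr X = −X e₀`, its
  plaquette sites `px`, the probe-box centre `cy X = X e₀` and box `box X N = X e₀ + [−N, N]⁴`.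

Dictionary to the crux: `G`-theory at `(β, L, a(β))` ↦ lattice Maxwell at spacing `a` (fixed Gaussian
coupling); Wilson loop `Re tr ρ(hol)` ↦ `cos Φ_C`; `dens G r y` ↦ `densA y`; `Ṽ_v` ↦ `probe`.
NOTHING here (nor in the five theorem files) proves the Yang–Mills mass gap, `BalabanLadder.NT`, or
X₁ itself: the rung is the free abelian model's instance of the X₁-shaped statement.
-/

set_option autoImplicit false

open MeasureTheory ProbabilityTheory Complex
open scoped Real NNReal ENNReal

noncomputable section

namespace Summit.QuantumFields.YangMills.Theorems.StaticSourceWitness.Rung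

/-! ## Part A — the Gaussian model -/

/-- The standard normal law `N(0,1)` on `ℝ`. [folklore] -/
abbrev γ : Measure ℝ := gaussianReal 0 1

/-- `t ↦ e^{−t²/2}` as a complex-valued function of a real variable (the characteristic function of
`γ`). [folklore] -/
def F (t : ℝ) : ℂ := Complex.exp ((-(t ^ 2 / 2) : ℝ) : ℂ)

/-- The law of `(ξ₁, ξ₂)`: two independent standard normals, `γ ⊗ γ`. [folklore] -/
abbrev μ2 : Measure (ℝ × ℝ) := γ.prod γ

/-- The Cholesky map `T_{s,p,q} (ξ₁, ξ₂) = (s ξ₁, p ξ₁ + q ξ₂)` as a continuous linear map: the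
centred Gaussian pair with `Var = s²`, `Cov = sp`, `Var = p² + q²` is `(γ ⊗ γ) ∘ T_{s,p,q}⁻¹`. [folklore] -/
def cholT (s p q : ℝ) : ℝ × ℝ →L[ℝ] ℝ × ℝ :=
  (s • ContinuousLinearMap.fst ℝ ℝ ℝ).prod
    (p • ContinuousLinearMap.fst ℝ ℝ ℝ + q • ContinuousLinearMap.snd ℝ ℝ ℝ)

/-! ## Part B — the lattice Maxwell field of `ℤ⁴` -/

section Lattice

open Literature.Probability.LatticeModels Literature.MathematicalPhysics.QuantumLattice
  Literature.MathematicalPhysics.QuantumFieldTheory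

/-- The lattice configuration space: `ℝ¹`-valued plaquette `2`-cochains of `ℤ⁴`. [folklore] -/
abbrev Cfg : Type := ZdPlaquette 4 → Fin 1 → ℝ

/-- The lattice Maxwell (curvature Gaussian) field of `ℤ⁴`, `curvatureGaussianField 4 1`
(Garban–Sepúlveda `dGd*` covariance, tree `curvatureTwoPoint`). [folklore] -/
abbrev μM : Measure Cfg := curvatureGaussianField 4 1

/-- An oriented coordinate plane `i < j` of `ℤ⁴`. [folklore] -/
abbrev Plane : Type := {p : Fin 4 × Fin 4 // p.1 < p.2}

/-- The plaquettes of the `R × T` rectangle based at the site `x` in the plane `ij`. [folklore] -/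
def rectPlaq (x : Site 4) (ij : Plane) (R T : ℕ) : Finset (ZdPlaquette 4) :=
  (Finset.range R ×ˢ Finset.range T).image
    fun mn => (x + (mn.1 : ℤ) • Pi.single ij.1.1 1 + (mn.2 : ℤ) • Pi.single ij.1.2 1, ij)

/-- The abelian holonomy angle of a plaquette set: `Φ_rect = ∑_{p ∈ rect} Y_p` (lattice Stokes for a
rectangle). [folklore] -/
def holonomy (rect : Finset (ZdPlaquette 4)) (ω : Cfg) : ℝ := ∑ p ∈ rect, ω p 0

/-- The abelian Wilson loop `w = cos Φ_rect`. [folklore] -/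
def wLoop (rect : Finset (ZdPlaquette 4)) (ω : Cfg) : ℝ := Real.cos (holonomy rect ω)

/-- The classical (linear-response) field of the source at the plaquette `q`:
`∑_{p ∈ rect} (dGd*)(p, q)`. -/
def dipoleField (rect : Finset (ZdPlaquette 4)) (q : ZdPlaquette 4) : ℝ :=
  ∑ p ∈ rect, curvatureTwoPoint p q

/-- The six plaquettes based at the site `y`. [folklore] -/
def plaqAt (y : Site 4) : Finset (ZdPlaquette 4) :=
  (Finset.univ : Finset Plane).image fun ij => (y, ij)

/-- The sites of the cube `[−L, L]⁴`. [folklore] -/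
def cube (L : ℕ) : Finset (Site 4) :=
  Fintype.piFinset fun _ : Fin 4 => Finset.Icc (-(L : ℤ)) L

/-- The abelian plaquette energy density at `y`: `∑_{q at y} Y_q²` (↦ the crux's `dens`). [folklore] -/
def densA (y : Site 4) (ω : Cfg) : ℝ := ∑ q ∈ plaqAt y, ω q 0 ^ 2

/-- The probe `Ṽ_v = ∑_{y ∈ cube L} v(a y) · densA y` at spacing `a` and volume cut-off `L`. -/
def probe (a : ℝ) (v : EuclideanSpace ℝ (Fin 4) → ℝ) (L : ℕ) (ω : Cfg) : ℝ :=
  ∑ y ∈ cube L, v (a • siteToE y) * densA y ω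

/-- The probe-weighted classical field energy of the source, `∑_y v(a y) ∑_{q at y} dipoleField(q)²`. -/
def dipoleEnergy (a : ℝ) (v : EuclideanSpace ℝ (Fin 4) → ℝ) (rect : Finset (ZdPlaquette 4)) (L : ℕ) : ℝ :=
  ∑ y ∈ cube L, v (a • siteToE y) * ∑ q ∈ plaqAt y, dipoleField rect q ^ 2

/-! ## Part C — the hyperscaling configuration -/

/-- The `(1,2)` coordinate plane of `ℤ⁴`. [folklore] -/
def P12 : Plane := ⟨((1 : Fin 4), (2 : Fin 4)), by decide⟩

/-- Squared Euclidean length `|z|²` of a site `z ∈ ℤ⁴`, as a real number. [folklore] -/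
def S (z : Site 4) : ℝ := ∑ j, ((z j : ℤ) : ℝ) ^ 2

/-- Centre `(ℓ/2) e₀` of the probe at window size `ℓ` (`e₀` the unit time vector of Euclidean `ℝ⁴`). -/
def ctr (ℓ : ℝ) : EuclideanSpace ℝ (Fin 4) := EuclideanSpace.single 0 (ℓ / 2)

/-- The smooth bump at window size `ℓ`: `= 1` on `B̄(ctr ℓ, ℓ/8)`, supported in `B̄(ctr ℓ, ℓ/4)`. -/
def bump (ℓ : ℝ) (hℓ : 0 < ℓ) : ContDiffBump (ctr ℓ) :=
  ⟨ℓ / 8, ℓ / 4, by positivity, by linarith⟩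

/-- The probe `wfun ℓ`: the bump `bump ℓ` as a Schwartz test function on Euclidean `ℝ⁴`. -/
def wfun (ℓ : ℝ) (hℓ : 0 < ℓ) : SchwartzMap (EuclideanSpace ℝ (Fin 4)) ℝ :=
  (bump ℓ hℓ).hasCompactSupport.toSchwartzMap (bump ℓ hℓ).contDiff

/-- Base point `−X e₀` of the source rectangle. -/
def xr (X : ℕ) : Site 4 := fun k => if k = 0 then -(X : ℤ) else 0

/-- The site of the `(m, n)` plaquette of the source rectangle based at `xr X` in the plane `(1,2)`. -/
def px (X m n : ℕ) : Site 4 := xr X + (m : ℤ) • Pi.single 1 1 + (n : ℤ) • Pi.single 2 1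

/-- Centre `X e₀` of the probe box. -/
def cy (X : ℕ) : Site 4 := fun k => if k = 0 then (X : ℤ) else 0

/-- The probe box `X e₀ + [−N, N]⁴` of lattice sites. -/
def box (X N : ℕ) : Finset (Site 4) :=
  Fintype.piFinset fun k => Finset.Icc (cy X k - N) (cy X k + N)

end Lattice

end Summit.QuantumFields.YangMills.Theorems.StaticSourceWitness.Rung

end
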